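import Summits.Ventures.PercRepro0.BoxLemma
import Summits.Ventures.PercRepro0.TrifCreate

/-!
# Lemma BOX with the uniqueness hypothesis discharged (seat p4, census supplement)

`BoxLemma.lemma_box` / `BoxLemma.lemma_box_pc` (TMID-census-p6-v2 §5, Lemma BOX) take P3 · UNIQUE as the hypothesis
`hP3 : P3_Unique d`. Since `TrifCreate.P3_Unique_all : ∀ d, P3_Unique d` is in the tree (Burton–Keane twin, seat p6),
the hypothesis is discharged here: the two statements below are Lemma BOX on `Defs` with NO hypothesis beyond
`θ_d(p) > 0` (resp. `θ_d(p_c(d)) > 0`) and `η > 0`. `BoxLemma.lean` itself is unchanged.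

Census evidence only, off every declaration path; nothing claimed on `T(d)` for any `d` — the statements are
implications whose antecedent `0 < θ_d(p_c(d))` is exactly the failure of `T(d)`.
-/

namespace Summit.Ventures.PercRepro0.BoxLemma

open MeasureTheory unitInterval Set
open Summit.Ventures.PercRepro0.Defs

variable {d : ℕ}

/-- **Lemma BOX, unconditional**: if `θ_d(p) > 0` then for every `η > 0` there is `N` with
`P_p(Λ_N ↔ Λ_N + x) ≥ 1 − 2η` for every `x ∈ ℤ^d` (P3 · UNIQUE supplied by `TrifCreate.P3_Unique_all`). -/
theorem lemma_box' {p : I} (hθ : 0 < thetaI d p) {η : ℝ} (hη : 0 < η) :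
    ∃ N : ℕ, ∀ x : Vertex d,
      1 - 2 * η ≤ (P d p (connSets d (box d N) ((· + x) '' box d N))).toReal :=
  lemma_box (TrifCreate.P3_Unique_all d) hθ hη

/-- **Lemma BOX at `p_c`, unconditional**: if `θ_d(p_c(d)) > 0` (i.e. `T(d)` fails) then for every `η > 0` some fixed
box size `N` has `P_{p_c(d)}(Λ_N ↔ Λ_N + x) ≥ 1 − 2η` for every `x` (P3 · UNIQUE supplied by
`TrifCreate.P3_Unique_all`). -/
theorem lemma_box_pc' (hθ : 0 < theta d (pc d)) {η : ℝ} (hη : 0 < η) :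
    ∃ N : ℕ, ∀ x : Vertex d,
      1 - 2 * η ≤ (P d (clamp (pc d)) (connSets d (box d N) ((· + x) '' box d N))).toReal :=
  lemma_box_pc (TrifCreate.P3_Unique_all d) hθ hη

end Summit.Ventures.PercRepro0.BoxLemma
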